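import Literature.NumberTheory.Sieve.FGKMT2018Prop91Reduction
import Literature.NumberTheory.Sieve.Maynard2016Lemma85LamBound
import HarnessLib

/-!
# Maynard 2016, Prop. 9.1 / FGKMT 2018, Thm 6 (7.12): the `y`-difference error, pointwise form

Source: J. Maynard, *Dense clusters of primes in subsets*, Compositio Math. 152 (2016) =
arXiv:1405.2593 [Maynard2016DenseClusters], proof of Proposition 9.1, p. 19 bottom – p. 20 top
(«We let `A = r/(r,s)` be the product of primes dividing `r` but not `(r,s)`, so that
`∏_{p∣rs} S_p(r,s) = μ(A)φ(r)/φ(A)` … By Lemma 8.2, for each such choice we have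
`y_s = y_r + O(T_k (Y_r + Y_s) log A/log R)` … Since `y_r ≤ Y_r/k` …»), with Lemma 8.2 p. 15;
K. Ford, B. Green, S. Konyagin, J. Maynard, T. Tao, *Long gaps between primes*, JAMS 31 (2018)
[FordGreenKonyaginMaynardTao2018], Thm 6 (7.12) pp. 21–22.

After `FGKMT2018Prop91Reduction` the only unevaluated piece of (7.12) is the `y`-difference term
`E_diff = Σ_{r,s ∈ 𝒟_k} y_r (y_s − y_r) T(r,s)/φ_ω(∏r)²`. This file proves the POINTWISE bound on its
summand (the printed step quoted above), for `r, s ∈ 𝒟_k(𝓛)` with `∏rᵢ = ∏sᵢ = m`: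
* `matchWt r s m = ∏_{p∣m, p at the same index in r and s} (p − 1)` and `|T(r,s)| = matchWt`
  (`abs_localPairSum_eq_matchWt`; this is `φ(r)/φ(A)`);
* `misProd r s m = A` = the product of the mismatched primes, and the `log A` bookkeeping for
  Lemma 8.2 (ii) with `tᵢ = [rᵢ, sᵢ]`: `Σᵢ (log[rᵢ,sᵢ] − log rᵢ) ≤ log A` (`sum_log_lcm_sub_log_le`);
* `|y_r| ≤ P F₂(u(r))/k` (`abs_yVar_le`, from `F ≤ F₁ ≤ F₂/k`);
* the pointwise bound `|y_r (y_s − y_r) T(r,s)| ≤ (30 + 30/U_k + T_k) P²/(k log R) · log A · matchWt ·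
  (F₂(u(r))² + F₂(u(r)) F₂(u(s)))` (`abs_ediff_summand_le`).
-/

noncomputable section

open Finset Real

namespace Literature.NumberTheory.Sieve.FGKMT2018

variable {k : ℕ}

/-! ### Matched and mismatched primes of a pair `r, s` with `∏rᵢ = ∏sᵢ` -/

/-- `p` sits at the same index in `r` and `s`. [cite: Maynard2016DenseClusters, proof of Prop. 9.1 p. 19 («p ∣ (r,s)»)] -/
abbrev Matched (r s : Fin k → ℕ) (p : ℕ) : Prop := ∃ i, p ∣ r i ∧ p ∣ s i

/-- `|∏_{p∣rs} S_p(r,s)| = ∏_{p ∣ (r,s)} (p − 1)` (`= φ(r)/φ(A)`).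
[cite: Maynard2016DenseClusters, proof of Prop. 9.1 p. 19, (9.5)] -/
def matchWt (r s : Fin k → ℕ) (m : ℕ) : ℝ :=
  ∏ p ∈ m.primeFactors, if Matched r s p then (p : ℝ) - 1 else 1

/-- Maynard's `A = r/(r,s)`: the product of the primes of `m = ∏rᵢ = ∏sᵢ` not dividing `(r,s) = ∏(rᵢ,sᵢ)`.
[cite: Maynard2016DenseClusters, proof of Prop. 9.1 p. 19 («A = r/(r,s)»)] -/
def misProd (r s : Fin k → ℕ) (m : ℕ) : ℕ :=
  ∏ p ∈ m.primeFactors.filter (fun p => ¬ Matched r s p), p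

/-- `p ∣ (r,s)` is symmetric in `r, s`. [cite: Maynard2016DenseClusters, proof of Prop. 9.1 p. 19 («(r,s)»)] -/
theorem matched_comm (r s : Fin k → ℕ) (p : ℕ) : Matched r s p ↔ Matched s r p :=
  ⟨fun ⟨i, h1, h2⟩ => ⟨i, h2, h1⟩, fun ⟨i, h1, h2⟩ => ⟨i, h2, h1⟩⟩

/-- `A(r,s) = A(s,r)`. [cite: Maynard2016DenseClusters, proof of Prop. 9.1 p. 19] -/
theorem misProd_comm (r s : Fin k → ℕ) (m : ℕ) : misProd r s m = misProd s r m := by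
  unfold misProd
  have h : m.primeFactors.filter (fun p => ¬ Matched r s p) =
      m.primeFactors.filter (fun p => ¬ Matched s r p) :=
    Finset.filter_congr fun p _ => by rw [matched_comm r s p]
  rw [h]

/-- `matchWt` is symmetric. [cite: Maynard2016DenseClusters, proof of Prop. 9.1 p. 19] -/
theorem matchWt_comm (r s : Fin k → ℕ) (m : ℕ) : matchWt r s m = matchWt s r m := by
  unfold matchWt
  refine Finset.prod_congr rfl fun p _ => ?_
  rw [if_congr (matched_comm r s p) rfl rfl]

/-- `A ≥ 1`. [cite: Maynard2016DenseClusters, proof of Prop. 9.1 p. 19 («A = r/(r,s)»)] -/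
theorem one_le_misProd (r s : Fin k → ℕ) (m : ℕ) : 1 ≤ misProd r s m := by
  unfold misProd
  exact Nat.one_le_iff_ne_zero.2 (Finset.prod_ne_zero_iff.2 fun p hp =>
    (Nat.prime_of_mem_primeFactors (Finset.mem_filter.1 hp).1).ne_zero)

/-- `∏_{p∣(r,s)}(p − 1) ≥ 0`. [cite: Maynard2016DenseClusters, proof of Prop. 9.1 p. 19, (9.5)] -/
theorem matchWt_nonneg (r s : Fin k → ℕ) (m : ℕ) : 0 ≤ matchWt r s m := by
  classical
  unfold matchWt
  refine Finset.prod_nonneg fun p hp => ?_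
  have h2 : (2 : ℝ) ≤ p := by exact_mod_cast (Nat.prime_of_mem_primeFactors hp).two_le
  split_ifs <;> linarith

/-- **`|T(r,s)| = ∏_{p ∣ (r,s)} (p − 1)`** for `r, s ∈ 𝒟_k(𝓛)` with `∏rᵢ = ∏sᵢ` — display (9.5):
`T = ∏_{p∣r} S_p` with `S_p = p − 1` if `p ∣ (r,s)` and `S_p = −1` otherwise.
[cite: Maynard2016DenseClusters, proof of Prop. 9.1 p. 19, (9.5) («= μ(A)φ(r)/φ(A)»)] -/
theorem abs_localPairSum_eq_matchWt {L : Fin k → ℤ × ℤ} {B : ℕ} {R : ℝ} {r s : Fin k → ℕ}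
    (hr : r ∈ dkBox L B R) (hs : s ∈ dkBox L B R) (heq : (∏ i, r i) = ∏ i, s i) :
    |localPairSum L B R r s| = matchWt r s (∏ i, r i) := by
  classical
  rw [localPairSum_eq_prod_localFactor hr hs heq, Finset.abs_prod]
  unfold matchWt
  refine Finset.prod_congr rfl fun p hp => ?_
  have h2 : (2 : ℝ) ≤ p := by exact_mod_cast (Nat.prime_of_mem_primeFactors hp).two_le
  unfold localFactor Matched
  split_ifs
  · exact abs_of_pos (by linarith)
  · simp

/-! ### The `log A` bookkeeping for Lemma 8.2 (ii) with `tᵢ = [rᵢ, sᵢ]` -/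

/-- For `r, s ∈ 𝒟_k(𝓛)` with `∏rᵢ = ∏sᵢ = m`: `∏ᵢ sᵢ/(rᵢ,sᵢ)` is a squarefree divisor of `m` all of whose
primes are mismatched, so `Σᵢ (log[rᵢ,sᵢ] − log rᵢ) = log ∏ᵢ sᵢ/(rᵢ,sᵢ) ≤ log A`.
[cite: Maynard2016DenseClusters, proof of Lemma 8.2 (ii) p. 16 («t_i = [r_i, s_i]», «log A/log R»), proof of Prop. 9.1 p. 19] -/
theorem sum_log_lcm_sub_log_le {L : Fin k → ℤ × ℤ} {B : ℕ} {R : ℝ} {r s : Fin k → ℕ}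
    (hr : r ∈ dkBox L B R) (hs : s ∈ dkBox L B R) (heq : (∏ i, r i) = ∏ i, s i) :
    ∑ i, (Real.log (Nat.lcm (r i) (s i) : ℕ) - Real.log (r i)) ≤
      Real.log (misProd r s (∏ i, r i)) := by
  classical
  have hr1 : ∀ i, 1 ≤ r i := one_le_of_mem_dkBox hr
  have hs1 : ∀ i, 1 ≤ s i := one_le_of_mem_dkBox hs
  have hmsq : Squarefree (∏ i, s i) := squarefree_of_mem_dkBox hs
  -- `qᵢ = sᵢ/(rᵢ,sᵢ)`, `[rᵢ,sᵢ] = rᵢ qᵢ`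
  set q : Fin k → ℕ := fun i => s i / Nat.gcd (r i) (s i) with hq
  have hgq : ∀ i, Nat.gcd (r i) (s i) * q i = s i := fun i =>
    Nat.mul_div_cancel' (Nat.gcd_dvd_right _ _)
  have hq0 : ∀ i, q i ≠ 0 := fun i h => by
    have h1 := hgq i
    rw [h, mul_zero] at h1
    exact absurd h1.symm (Nat.one_le_iff_ne_zero.1 (hs1 i))
  have hlcm : ∀ i, Nat.lcm (r i) (s i) = r i * q i := fun i => by
    have hg : 0 < Nat.gcd (r i) (s i) := Nat.gcd_pos_of_pos_left _ (hr1 i)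
    refine Nat.eq_of_mul_eq_mul_left hg ?_
    rw [Nat.gcd_mul_lcm]
    conv_lhs => rw [← hgq i]
    ring
  -- the sum is `log ∏ qᵢ`
  have hsum : ∑ i, (Real.log (Nat.lcm (r i) (s i) : ℕ) - Real.log (r i)) =
      Real.log ((∏ i, q i : ℕ) : ℝ) := by
    rw [Nat.cast_prod, Real.log_prod]
    · refine Finset.sum_congr rfl fun i _ => ?_
      have hri : (r i : ℝ) ≠ 0 := by exact_mod_cast Nat.one_le_iff_ne_zero.1 (hr1 i)
      have hqi : (q i : ℝ) ≠ 0 := by exact_mod_cast hq0 i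
      rw [hlcm i, Nat.cast_mul, Real.log_mul hri hqi]
      ring
    · intro i _
      exact_mod_cast hq0 i
  rw [hsum]
  -- `Q = ∏ qᵢ ∣ ∏ sᵢ`, squarefree, primes mismatched
  set Q := ∏ i, q i with hQ
  have hQdvd : Q ∣ ∏ i, s i := Finset.prod_dvd_prod_of_dvd _ _ fun i _ =>
    Nat.div_dvd_of_dvd (Nat.gcd_dvd_right _ _)
  have hQsq : Squarefree Q := hmsq.squarefree_of_dvd hQdvd
  have hQ0 : Q ≠ 0 := hQsq.ne_zero
  have hsub : Q.primeFactors ⊆ (∏ i, r i).primeFactors.filter (fun p => ¬ Matched r s p) := by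
    intro p hp
    have hpp := Nat.prime_of_mem_primeFactors hp
    have hpQ := Nat.dvd_of_mem_primeFactors hp
    obtain ⟨i, -, hpi⟩ := hpp.prime.exists_mem_finset_dvd hpQ
    have hpsi : p ∣ s i := hpi.trans (Nat.div_dvd_of_dvd (Nat.gcd_dvd_right _ _))
    rw [Finset.mem_filter, heq]
    refine ⟨Nat.mem_primeFactors.2 ⟨hpp, hpsi.trans (Finset.dvd_prod_of_mem _ (Finset.mem_univ i)),
      hmsq.ne_zero⟩, ?_⟩
    rintro ⟨i', hri', hsi'⟩
    have hii : i' = i := by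
      by_contra hne
      have hc := coprime_apply_of_mem_dkBox hs hne
      exact hpp.one_lt.ne' (Nat.eq_one_of_dvd_coprimes hc hsi' hpsi)
    subst hii
    -- `p ∣ (rᵢ,sᵢ)` and `p ∣ sᵢ/(rᵢ,sᵢ)` ⇒ `p² ∣ sᵢ`
    have hpg : p ∣ Nat.gcd (r i') (s i') := Nat.dvd_gcd hri' hsi'
    have hp2 : p * p ∣ s i' := by
      rw [← hgq i']
      exact mul_dvd_mul hpg hpi
    exact hpp.one_lt.ne' (Nat.isUnit_iff.1 (squarefree_apply_of_mem_dkBox hs i' p hp2))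
  have hle : Q ≤ misProd r s (∏ i, r i) := by
    rw [← Nat.prod_primeFactors_of_squarefree hQsq]
    unfold misProd
    exact Finset.prod_le_prod_of_subset_of_one_le' hsub fun p hp _ =>
      (Nat.prime_of_mem_primeFactors (Finset.mem_filter.1 hp).1).one_lt.le
  exact Real.log_le_log (by exact_mod_cast Nat.pos_of_ne_zero hQ0) (by exact_mod_cast hle)

/-- `rᵢ ≤ [rᵢ, sᵢ]` for `r ∈ 𝒟_k` (all `rᵢ, sᵢ ≥ 1`). [cite: Maynard2016DenseClusters, proof of Lemma 8.2 (ii) p. 16] -/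
theorem le_lcm_of_mem_dkBox {L : Fin k → ℤ × ℤ} {B : ℕ} {R : ℝ} {r s : Fin k → ℕ}
    (hr : r ∈ dkBox L B R) (hs : s ∈ dkBox L B R) (i : Fin k) : r i ≤ Nat.lcm (r i) (s i) :=
  Nat.le_of_dvd (Nat.lcm_pos (one_le_of_mem_dkBox hr i) (one_le_of_mem_dkBox hs i))
    (Nat.dvd_lcm_left _ _)

/-! ### `|y_r| ≤ P F₂(u(r))/k` and the pointwise bound -/

/-- The prefactor `P = (WB)^k/φ(WB)^k · 𝔖_{WB}(𝓛)` of `y_r`. [cite: Maynard2016DenseClusters, §7 p. 14] -/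
def yPref (L : Fin k → ℤ × ℤ) (B : ℕ) : ℝ :=
  ((wCut k B * B : ℕ) : ℝ) ^ k / (Nat.totient (wCut k B * B) : ℝ) ^ k * singSeriesExcl L (wCut k B * B)

/-- `u(r) = (log rᵢ/log R)ᵢ`. [cite: Maynard2016DenseClusters, Lemma 8.2 p. 15] -/
def logVec (R : ℝ) (r : Fin k → ℕ) : Fin k → ℝ := fun i => Real.log (r i) / Real.log R

/-- **`|y_r| ≤ P F₂(u(r))/k`** («since `y_r ≤ Y_r/k`»): `y_r = P F(u(r))`, `F ≤ F₁`, `k F₁ ≤ F₂`.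
[cite: Maynard2016DenseClusters, proof of Prop. 9.1 p. 20 («Since y_r ≤ Y_r/k»), Lemma 8.6] -/
theorem abs_yVar_le {L : Fin k → ℤ × ℤ} (hadm : FormsAdmissible L) (hnd : FormsNondegenerate L)
    (hk : 2 ≤ k) {B : ℕ} (hB : B ≠ 0) {R : ℝ} (hR : 1 ≤ R) {r : Fin k → ℕ} (hr : ∀ i, 1 ≤ r i) :
    |yVar L B R (MaynardDense.F k) r| ≤ yPref L B * MaynardDense.F₂ k (logVec R r) / k := by
  have hP : 0 < yPref L B := yPref_pos hadm hnd (le_trans (by norm_num) hk) hB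
  have ht : logVec R r ∈ MaynardDense.orthant k := logVec_mem_orthant hR r hr
  have hk0 : (0 : ℝ) < k := by exact_mod_cast lt_of_lt_of_le (by norm_num) hk
  rw [yVar_eq_mul_F L B hR r hr]
  change |yPref L B * MaynardDense.F k (logVec R r)| ≤ _
  rw [abs_of_nonneg (mul_nonneg hP.le (MaynardDense.F_nonneg hk ht)), mul_div_assoc]
  refine mul_le_mul_of_nonneg_left ?_ hP.le
  rw [le_div_iff₀ hk0, mul_comm]
  exact le_trans (mul_le_mul_of_nonneg_left (MaynardDense.F_le_F₁ hk ht) hk0.le)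
    (MaynardDense.mul_F₁_le_F₂ hk ht)

/-- **Lemma 8.2 (ii) for a pair with `∏rᵢ = ∏sᵢ`**: `|y_s − y_r| ≤ (30 + 30/U_k + T_k) P (log A/log R)
(F₂(u(r)) + F₂(u(s)))`, with `A` the product of the mismatched primes.
[cite: Maynard2016DenseClusters, Lemma 8.2 (ii) p. 15, proof of Prop. 9.1 p. 19 («y_s = y_r + O(T_k(Y_r+Y_s) log A/log R)»)] -/
theorem abs_yVar_sub_yVar_le_logMisProd {L : Fin k → ℤ × ℤ} (hk : 2 ≤ k) {B : ℕ} {R : ℝ}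
    (hR : 1 < R) {r s : Fin k → ℕ} (hr : r ∈ dkBox L B R) (hs : s ∈ dkBox L B R)
    (heq : (∏ i, r i) = ∏ i, s i) :
    |yVar L B R (MaynardDense.F k) s - yVar L B R (MaynardDense.F k) r| ≤
      (30 + 30 / MaynardDense.U k + MaynardDense.T k) * |yPref L B| *
        (Real.log (misProd r s (∏ i, r i)) / Real.log R *
          (MaynardDense.F₂ k (logVec R r) + MaynardDense.F₂ k (logVec R s))) := by
  have hr1 : ∀ i, 1 ≤ r i := one_le_of_mem_dkBox hr
  have hs1 : ∀ i, 1 ≤ s i := one_le_of_mem_dkBox hs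
  have hlogR : 0 < Real.log R := Real.log_pos hR
  have h82 := abs_yVar_sub_yVar_le hk L B hR r s (fun i => Nat.lcm (r i) (s i)) hr1 hs1
    (fun i => le_lcm_of_mem_dkBox hr hs i)
    (fun i => by rw [Nat.lcm_comm]; exact le_lcm_of_mem_dkBox hs hr i)
  refine h82.trans ?_
  have hC : 0 ≤ (30 + 30 / MaynardDense.U k + MaynardDense.T k) * |yPref L B| := by
    have hU : 0 < MaynardDense.U k := by
      unfold MaynardDense.U; positivity
    have hT : 0 < MaynardDense.T k := MaynardDense.T_pos hk
    positivity
  change _ * (((∑ i, (Real.log (Nat.lcm (r i) (s i) : ℕ) - Real.log (r i))) / Real.log R) *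
      MaynardDense.F₂ k (logVec R r) +
    ((∑ i, (Real.log (Nat.lcm (r i) (s i) : ℕ) - Real.log (s i))) / Real.log R) *
      MaynardDense.F₂ k (logVec R s)) ≤ _
  refine mul_le_mul_of_nonneg_left ?_ hC
  have hFr : 0 ≤ MaynardDense.F₂ k (logVec R r) :=
    MaynardDense.F₂_nonneg hk (logVec_mem_orthant hR.le r hr1)
  have hFs : 0 ≤ MaynardDense.F₂ k (logVec R s) :=
    MaynardDense.F₂_nonneg hk (logVec_mem_orthant hR.le s hs1)
  have h1 := sum_log_lcm_sub_log_le hr hs heq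
  have h2 := sum_log_lcm_sub_log_le hs hr heq.symm
  rw [← heq, misProd_comm s r] at h2
  have h2' : ∑ i, (Real.log (Nat.lcm (r i) (s i) : ℕ) - Real.log (s i)) ≤
      Real.log (misProd r s (∏ i, r i)) := by
    refine le_trans (le_of_eq (Finset.sum_congr rfl fun i _ => by rw [Nat.lcm_comm])) h2
  rw [mul_add]
  exact add_le_add (mul_le_mul_of_nonneg_right (div_le_div_of_nonneg_right h1 hlogR.le) hFr)
    (mul_le_mul_of_nonneg_right (div_le_div_of_nonneg_right h2' hlogR.le) hFs)

/-- **The pointwise bound on the `E_diff` summand** (Maynard p. 19–20): for `r, s ∈ 𝒟_k(𝓛)` with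
`∏rᵢ = ∏sᵢ`, `|y_r (y_s − y_r) T(r,s)| ≤ (30 + 30/U_k + T_k) P²/(k log R) · log A · ∏_{p∣(r,s)}(p−1) ·
(F₂(u(r))² + F₂(u(r)) F₂(u(s)))`.
[cite: Maynard2016DenseClusters, proof of Prop. 9.1 pp. 19–20 («y_s = y_r + O(T_k(Y_r+Y_s) log A/log R)», «y_r ≤ Y_r/k», (9.5))] -/
theorem abs_ediff_summand_le {L : Fin k → ℤ × ℤ} (hadm : FormsAdmissible L) (hnd : FormsNondegenerate L)
    (hk : 2 ≤ k) {B : ℕ} (hB : B ≠ 0) {R : ℝ} (hR : 1 < R) {r s : Fin k → ℕ}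
    (hr : r ∈ dkBox L B R) (hs : s ∈ dkBox L B R) (heq : (∏ i, r i) = ∏ i, s i) :
    |yVar L B R (MaynardDense.F k) r *
        (yVar L B R (MaynardDense.F k) s - yVar L B R (MaynardDense.F k) r) *
        localPairSum L B R r s| ≤
      (30 + 30 / MaynardDense.U k + MaynardDense.T k) * yPref L B ^ 2 / (k * Real.log R) *
        (Real.log (misProd r s (∏ i, r i)) * matchWt r s (∏ i, r i) *
          (MaynardDense.F₂ k (logVec R r) ^ 2 +
            MaynardDense.F₂ k (logVec R r) * MaynardDense.F₂ k (logVec R s))) := by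
  have hr1 : ∀ i, 1 ≤ r i := one_le_of_mem_dkBox hr
  have hs1 : ∀ i, 1 ≤ s i := one_le_of_mem_dkBox hs
  have hP : 0 < yPref L B := yPref_pos hadm hnd (le_trans (by norm_num) hk) hB
  have hk0 : (0 : ℝ) < k := by exact_mod_cast lt_of_lt_of_le (by norm_num) hk
  have hlogR : 0 < Real.log R := Real.log_pos hR
  have hy := abs_yVar_le hadm hnd hk hB hR.le hr1
  have hd := abs_yVar_sub_yVar_le_logMisProd hk hR hr hs heq
  have hT := abs_localPairSum_eq_matchWt hr hs heq
  rw [abs_mul, abs_mul, hT]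
  rw [abs_of_pos hP] at hd
  change |yVar L B R (MaynardDense.F k) r| ≤ yPref L B * MaynardDense.F₂ k (logVec R r) / k at hy
  set C := 30 + 30 / MaynardDense.U k + MaynardDense.T k with hC
  set P := yPref L B
  set Fr := MaynardDense.F₂ k (logVec R r)
  set Fs := MaynardDense.F₂ k (logVec R s)
  set lA := Real.log (misProd r s (∏ i, r i))
  set M := matchWt r s (∏ i, r i)
  have hFr : 0 ≤ Fr := MaynardDense.F₂_nonneg hk (logVec_mem_orthant hR.le r hr1)
  have hFs : 0 ≤ Fs := MaynardDense.F₂_nonneg hk (logVec_mem_orthant hR.le s hs1)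
  have hM : 0 ≤ M := matchWt_nonneg r s _
  have hlA : 0 ≤ lA := Real.log_nonneg (by exact_mod_cast one_le_misProd r s _)
  have hC0 : 0 ≤ C := by
    have hU : 0 < MaynardDense.U k := by unfold MaynardDense.U; positivity
    have := MaynardDense.T_pos hk
    positivity
  calc |yVar L B R (MaynardDense.F k) r| *
        |yVar L B R (MaynardDense.F k) s - yVar L B R (MaynardDense.F k) r| * M
      ≤ (P * Fr / k) * (C * P * (lA / Real.log R * (Fr + Fs))) * M := by
        refine mul_le_mul_of_nonneg_right ?_ hM
        exact mul_le_mul hy hd (abs_nonneg _) (by positivity)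
    _ = C * P ^ 2 / (k * Real.log R) * (lA * M * (Fr ^ 2 + Fr * Fs)) := by
        field_simp

/-! ### Summing over `r, s`: symmetrisation -/

/-- The symmetric kernel `g(r,s) = [∏s = ∏r] · log A(r,s) · ∏_{p∣(r,s)}(p−1)/φ_ω(∏r)²`.
[cite: Maynard2016DenseClusters, proof of Prop. 9.1 pp. 19–20] -/
def ediffKernel (L : Fin k → ℤ × ℤ) (r s : Fin k → ℕ) : ℝ :=
  if (∏ i, s i) = ∏ i, r i then
    Real.log (misProd r s (∏ i, r i)) * matchWt r s (∏ i, r i) / phiOmega L (∏ i, r i) ^ 2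
  else 0

/-- The kernel is symmetric (`A`, `(r,s)` and `φ_ω(∏r) = φ_ω(∏s)` are).
[cite: Maynard2016DenseClusters, proof of Prop. 9.1 pp. 19–20] -/
theorem ediffKernel_comm (L : Fin k → ℤ × ℤ) (r s : Fin k → ℕ) :
    ediffKernel L s r = ediffKernel L r s := by
  unfold ediffKernel
  by_cases h : (∏ i, s i) = ∏ i, r i
  · rw [if_pos h.symm, if_pos h, h, misProd_comm s r, matchWt_comm s r]
  · rw [if_neg (Ne.symm h), if_neg h]

/-- The kernel is non-negative. [cite: Maynard2016DenseClusters, proof of Prop. 9.1 pp. 19–20] -/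
theorem ediffKernel_nonneg (L : Fin k → ℤ × ℤ) (r s : Fin k → ℕ) : 0 ≤ ediffKernel L r s := by
  unfold ediffKernel
  split_ifs
  · exact div_nonneg (mul_nonneg (Real.log_nonneg (by exact_mod_cast one_le_misProd r s _))
      (matchWt_nonneg r s _)) (sq_nonneg _)
  · exact le_rfl

/-- Pointwise bound in kernel form (zero when `∏rᵢ ≠ ∏sᵢ` by `localPairSum_eq_zero_of_prod_ne`), with
`F₂(u(r))F₂(u(s)) ≤ (F₂(u(r))² + F₂(u(s))²)/2`.
[cite: Maynard2016DenseClusters, proof of Prop. 9.1 pp. 19–20; Lemma 8.2] -/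
theorem abs_ediff_summand_le_kernel {L : Fin k → ℤ × ℤ} (hadm : FormsAdmissible L)
    (hnd : FormsNondegenerate L) (hk : 2 ≤ k) {B : ℕ} (hB : B ≠ 0) {R : ℝ} (hR : 1 < R)
    {r s : Fin k → ℕ} (hr : r ∈ dkBox L B R) (hs : s ∈ dkBox L B R) :
    |yVar L B R (MaynardDense.F k) r *
          (yVar L B R (MaynardDense.F k) s - yVar L B R (MaynardDense.F k) r) /
        phiOmega L (∏ i, r i) ^ 2 * localPairSum L B R r s| ≤
      (30 + 30 / MaynardDense.U k + MaynardDense.T k) * yPref L B ^ 2 / (k * Real.log R) *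
        (ediffKernel L r s * (3 / 2 * MaynardDense.F₂ k (logVec R r) ^ 2 +
          1 / 2 * MaynardDense.F₂ k (logVec R s) ^ 2)) := by
  have hr1 : ∀ i, 1 ≤ r i := one_le_of_mem_dkBox hr
  have hs1 : ∀ i, 1 ≤ s i := one_le_of_mem_dkBox hs
  set C' := (30 + 30 / MaynardDense.U k + MaynardDense.T k) * yPref L B ^ 2 / (k * Real.log R)
    with hC'
  have hC'0 : 0 ≤ C' := by
    have hU : 0 < MaynardDense.U k := by unfold MaynardDense.U; positivity
    have := MaynardDense.T_pos hk
    have hlogR : 0 < Real.log R := Real.log_pos hR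
    positivity
  have hFr : 0 ≤ MaynardDense.F₂ k (logVec R r) :=
    MaynardDense.F₂_nonneg hk (logVec_mem_orthant hR.le r hr1)
  have hFs : 0 ≤ MaynardDense.F₂ k (logVec R s) :=
    MaynardDense.F₂_nonneg hk (logVec_mem_orthant hR.le s hs1)
  by_cases heq : (∏ i, r i) = ∏ i, s i
  · have hφ : 0 < phiOmega L (∏ i, r i) := phiOmega_prod_pos_of_mem_dkBox hadm hr
    have h := abs_ediff_summand_le hadm hnd hk hB hR hr hs heq
    rw [mul_comm _ (localPairSum L B R r s), ← mul_div_assoc, mul_comm (localPairSum L B R r s),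
      abs_div, abs_of_pos (pow_pos hφ 2), div_le_iff₀ (pow_pos hφ 2)]
    refine h.trans ?_
    have hker : ediffKernel L r s * phiOmega L (∏ i, r i) ^ 2 =
        Real.log (misProd r s (∏ i, r i)) * matchWt r s (∏ i, r i) := by
      unfold ediffKernel
      rw [if_pos heq.symm, div_mul_cancel₀ _ (pow_pos hφ 2).ne']
    have hlA : 0 ≤ Real.log (misProd r s (∏ i, r i)) :=
      Real.log_nonneg (by exact_mod_cast one_le_misProd r s _)
    have hM : 0 ≤ matchWt r s (∏ i, r i) := matchWt_nonneg r s _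
    have hsq : MaynardDense.F₂ k (logVec R r) ^ 2 +
        MaynardDense.F₂ k (logVec R r) * MaynardDense.F₂ k (logVec R s) ≤
        3 / 2 * MaynardDense.F₂ k (logVec R r) ^ 2 + 1 / 2 * MaynardDense.F₂ k (logVec R s) ^ 2 := by
      nlinarith [sq_nonneg (MaynardDense.F₂ k (logVec R r) - MaynardDense.F₂ k (logVec R s))]
    calc C' * (Real.log (misProd r s (∏ i, r i)) * matchWt r s (∏ i, r i) *
          (MaynardDense.F₂ k (logVec R r) ^ 2 +
            MaynardDense.F₂ k (logVec R r) * MaynardDense.F₂ k (logVec R s)))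
        ≤ C' * (Real.log (misProd r s (∏ i, r i)) * matchWt r s (∏ i, r i) *
          (3 / 2 * MaynardDense.F₂ k (logVec R r) ^ 2 +
            1 / 2 * MaynardDense.F₂ k (logVec R s) ^ 2)) :=
          mul_le_mul_of_nonneg_left (mul_le_mul_of_nonneg_left hsq (mul_nonneg hlA hM)) hC'0
      _ = C' * (ediffKernel L r s * (3 / 2 * MaynardDense.F₂ k (logVec R r) ^ 2 +
            1 / 2 * MaynardDense.F₂ k (logVec R s) ^ 2)) * phiOmega L (∏ i, r i) ^ 2 := by
          rw [← hker]; ring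
  · rw [localPairSum_eq_zero_of_prod_ne hr hs heq, mul_zero, abs_zero]
    exact mul_nonneg hC'0 (mul_nonneg (ediffKernel_nonneg L r s) (by positivity))

/-- **The `y`-difference error after symmetrisation**: `|E_diff| ≤ 2 (30+30/U_k+T_k) P²/(k log R) ·
Σ_{r ∈ 𝒟} F₂(u(r))²/φ_ω(∏r)² · Σ_{s ∈ 𝒟, ∏s = ∏r} log A(r,s) ∏_{p∣(r,s)} (p − 1)`; the inner sum is the
«choices of `s` given `A`» count of the printed proof.
[cite: Maynard2016DenseClusters, proof of Prop. 9.1 pp. 19–20 («Thus the error … contributes …»); FordGreenKonyaginMaynardTao2018, Theorem 6 (7.12) p. 21] -/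
theorem abs_ediff_le_sum_kernel {L : Fin k → ℤ × ℤ} (hadm : FormsAdmissible L)
    (hnd : FormsNondegenerate L) (hk : 2 ≤ k) {B : ℕ} (hB : B ≠ 0) {R : ℝ} (hR : 1 < R) :
    |∑ r ∈ dkBox L B R, ∑ s ∈ dkBox L B R,
        yVar L B R (MaynardDense.F k) r *
            (yVar L B R (MaynardDense.F k) s - yVar L B R (MaynardDense.F k) r) /
          phiOmega L (∏ i, r i) ^ 2 * localPairSum L B R r s| ≤
      2 * ((30 + 30 / MaynardDense.U k + MaynardDense.T k) * yPref L B ^ 2 / (k * Real.log R)) *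
        ∑ r ∈ dkBox L B R, MaynardDense.F₂ k (logVec R r) ^ 2 / phiOmega L (∏ i, r i) ^ 2 *
          ∑ s ∈ (dkBox L B R).filter (fun s => (∏ i, s i) = ∏ i, r i),
            Real.log (misProd r s (∏ i, r i)) * matchWt r s (∏ i, r i) := by
  set D := dkBox L B R with hD
  set C' := (30 + 30 / MaynardDense.U k + MaynardDense.T k) * yPref L B ^ 2 / (k * Real.log R)
    with hC'
  set Fq : (Fin k → ℕ) → ℝ := fun r => MaynardDense.F₂ k (logVec R r) ^ 2 with hFq
  -- pointwise, then sum
  have hpt : ∀ r ∈ D, ∀ s ∈ D,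
      |yVar L B R (MaynardDense.F k) r *
            (yVar L B R (MaynardDense.F k) s - yVar L B R (MaynardDense.F k) r) /
          phiOmega L (∏ i, r i) ^ 2 * localPairSum L B R r s| ≤
        C' * (ediffKernel L r s * (3 / 2 * Fq r + 1 / 2 * Fq s)) :=
    fun r hr s hs => abs_ediff_summand_le_kernel hadm hnd hk hB hR hr hs
  have h1 : |∑ r ∈ D, ∑ s ∈ D,
        yVar L B R (MaynardDense.F k) r *
            (yVar L B R (MaynardDense.F k) s - yVar L B R (MaynardDense.F k) r) /
          phiOmega L (∏ i, r i) ^ 2 * localPairSum L B R r s| ≤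
      ∑ r ∈ D, ∑ s ∈ D, C' * (ediffKernel L r s * (3 / 2 * Fq r + 1 / 2 * Fq s)) := by
    refine (Finset.abs_sum_le_sum_abs _ _).trans (Finset.sum_le_sum fun r hr => ?_)
    exact (Finset.abs_sum_le_sum_abs _ _).trans (Finset.sum_le_sum fun s hs => hpt r hr s hs)
  refine h1.trans (le_of_eq ?_)
  -- symmetrisation: `ΣΣ g(r,s) Fq s = ΣΣ g(r,s) Fq r`
  have hswap : ∑ r ∈ D, ∑ s ∈ D, ediffKernel L r s * Fq s = ∑ r ∈ D, ∑ s ∈ D, ediffKernel L r s * Fq r := by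
    rw [Finset.sum_comm]
    refine Finset.sum_congr rfl fun s _ => Finset.sum_congr rfl fun r _ => ?_
    rw [ediffKernel_comm]
  have hlhs : ∑ r ∈ D, ∑ s ∈ D, C' * (ediffKernel L r s * (3 / 2 * Fq r + 1 / 2 * Fq s)) =
      C' * (3 / 2 * ∑ r ∈ D, ∑ s ∈ D, ediffKernel L r s * Fq r +
        1 / 2 * ∑ r ∈ D, ∑ s ∈ D, ediffKernel L r s * Fq s) := by
    rw [Finset.mul_sum, Finset.mul_sum, ← Finset.sum_add_distrib, Finset.mul_sum]
    refine Finset.sum_congr rfl fun r _ => ?_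
    rw [Finset.mul_sum, Finset.mul_sum, ← Finset.sum_add_distrib, Finset.mul_sum]
    refine Finset.sum_congr rfl fun s _ => ?_
    ring
  rw [hlhs, hswap]
  -- inner sum: `Σ_s g(r,s) Fq r = Fq r/φ² Σ_{s, ∏s=∏r} log A · matchWt`
  have hinner : ∀ r ∈ D, ∑ s ∈ D, ediffKernel L r s * Fq r =
      Fq r / phiOmega L (∏ i, r i) ^ 2 *
        ∑ s ∈ D.filter (fun s => (∏ i, s i) = ∏ i, r i),
          Real.log (misProd r s (∏ i, r i)) * matchWt r s (∏ i, r i) := by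
    intro r hr
    rw [Finset.sum_filter, Finset.mul_sum]
    refine Finset.sum_congr rfl fun s _ => ?_
    unfold ediffKernel
    split_ifs
    · ring
    · simp
  rw [Finset.sum_congr rfl hinner]
  ring

end Literature.NumberTheory.Sieve.FGKMT2018
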